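import Summits.ValiantsHypothesis.ValiantsHypothesis.Theorems.MonotoneRestorationOrbitCompressionQPNarrowToOrbit
import Literature.Computability.AlgebraicComplexity.DiPatternExpressions
import HarnessLib

/-!
# Route MonotoneRestoration — aside `OrbitCompressionQP` (stmt-ValiantsHypothesis-18332): ONE-SORTED NARROW
# EXPRESSIONS HAVE QUASI-POLYNOMIAL ORBITS

One-sorted companion of `…OrbitCompressionQPNarrowToOrbit.lean`.  Square-symmetric circuits (diagonal
`Sym_n`) compute ONE-SORTED quantities — the trace `Σ_i x_ii` kills the registered bipartite
`stub_orbitToNarrowExpression` (p819407) and is the closed one-sorted expression `edge 0 0` with one label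
(`DiPatternExpr.close_edge_self`).  In the one-sorted currency (`Literature.…DiPatternExpressions`:
`DiPatternExpr R k`, labels used both as row and column indices) the easy direction of the conjectured
characterisation "square-symmetric circuits of quasi-polynomial ORBIT size = closed one-sorted expressions
with polylogarithmically many labels" (Dawar–Pago–Seppelt 2025, p. 17 Remark / p. 45, for `Sym_n`) holds
for expressions of ANY length:

* `exists_valueDerivation_diValue` / `exists_valueDerivation_diClose` — the values of a one-sorted
  expression with `k` labels form a value derivation every value of which is fixed by the pointwise
  stabiliser of at most `k` indices;
* `exists_symmetric_orbit_le_of_diClose` — hence `e.close n` has a square-symmetric circuit of orbit size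
  `≤ (n+1)^{2k+4}`, whatever the length of `e`;
* `qpOrbit_of_diNarrowExpression` — a family presented at every `n ≥ 1` by closed one-sorted expressions
  with `n^{k_n} ≤ 2^{(log₂ n + c)^c}` labels has square-symmetric circuits of quasi-polynomial orbit size
  (hence, with `OrbitSupport.supportedDerivations_of_qpOrbitFamily`, polylog-supported computations: the
  two one-sorted presentations "narrow expression" ⇒ "qp orbit" ⇒ "polylog supports" — the missing arrow
  back is the extraction S1b′ of the item's evidence `S1b-plan.md`).

Helper file (`--supports stmt-ValiantsHypothesis-18332`); def-free; nothing here is a named fact.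
-/

noncomputable section

open scoped Classical

-- `Summit.ValiantsHypothesis.ValiantsHypothesis.…` is the tree's single-conjunct layout (Sub = Summit).
set_option linter.dupNamespace false

namespace Summit.ValiantsHypothesis.ValiantsHypothesis.Theorems

namespace NarrowToOrbit

open Literature.Computability.AlgebraicComplexity MvPolynomial

variable {k : ℕ} (n : ℕ)

/-- The diagonal action on a one-sorted value is relabelling the assignment. [cite: DawarPagoSeppelt2025, §5] -/
theorem ren_diValue (σ : Equiv.Perm (Fin n)) (e : DiPatternExpr ℂ k) (ℓ : Fin k → Fin n) :
    ren σ (e.value n ℓ) = e.value n (σ ∘ ℓ) :=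
  DiPatternExpr.rename_value n σ e ℓ

/-- **One-sorted values are supported on their labels.** [folklore] -/
theorem ren_diValue_of_fix (σ : Equiv.Perm (Fin n)) (e : DiPatternExpr ℂ k) (ℓ : Fin k → Fin n)
    (hσ : ∀ i ∈ Finset.univ.image ℓ, σ i = i) : ren σ (e.value n ℓ) = e.value n ℓ := by
  rw [ren_diValue]
  have hℓ : σ ∘ ℓ = ℓ := funext fun a => hσ _ (Finset.mem_image_of_mem ℓ (Finset.mem_univ a))
  rw [hℓ]

/-- There are at most `k` labels. [folklore] -/
theorem card_diLabels_le (ℓ : Fin k → Fin n) : (Finset.univ.image ℓ).card ≤ k :=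
  Finset.card_image_le.trans (by simp)

/-- **The values of a one-sorted expression form a supported value derivation** (supports = the labels,
at most `k`). [cite: DawarPagoSeppelt2025, §5] -/
theorem exists_valueDerivation_diValue (e : DiPatternExpr ℂ k) :
    ∃ 𝒟 : ValueDerivation ℂ (Fin n × Fin n),
      (∀ ℓ : Fin k → Fin n, e.value n ℓ ∈ 𝒟.S) ∧
      ∀ q ∈ 𝒟.S, ∃ T : Finset (Fin n), T.card ≤ k ∧
        ∀ σ : Equiv.Perm (Fin n), (∀ i ∈ T, σ i = i) → ren σ q = q := by
  induction e with
  | edge a b =>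
    refine ⟨⟨Finset.univ.image fun ℓ : Fin k → Fin n => (DiPatternExpr.edge a b : DiPatternExpr ℂ k).value n ℓ,
      fun _ => 0, ?_⟩, ?_, ?_⟩
    · intro q hq
      obtain ⟨ℓ, -, rfl⟩ := Finset.mem_image.1 hq
      exact ⟨StepData.var (ℓ a, ℓ b), ⟨rfl, fun u hu => by simp [StepData.args] at hu⟩⟩
    · intro ℓ
      exact Finset.mem_image.2 ⟨ℓ, Finset.mem_univ _, rfl⟩
    · intro q hq
      obtain ⟨ℓ, -, rfl⟩ := Finset.mem_image.1 hq
      exact ⟨_, card_diLabels_le n ℓ, fun σ hσ => ren_diValue_of_fix n σ _ ℓ hσ⟩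
  | const c =>
    refine ⟨⟨{(C c : MvPolynomial (Fin n × Fin n) ℂ)}, fun _ => 0, ?_⟩, ?_, ?_⟩
    · intro q hq
      rw [Finset.mem_singleton] at hq
      subst hq
      exact ⟨StepData.const c, ⟨rfl, fun u hu => by simp [StepData.args] at hu⟩⟩
    · intro ℓ
      exact Finset.mem_singleton.2 rfl
    · intro q hq
      rw [Finset.mem_singleton] at hq
      subst hq
      exact ⟨∅, by simp, fun σ _ => ren_C σ c⟩
  | add e₁ e₂ ih₁ ih₂ =>
    obtain ⟨𝒟₁, hv₁, hs₁⟩ := ih₁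
    obtain ⟨𝒟₂, hv₂, hs₂⟩ := ih₂
    obtain ⟨𝒟, h𝒟⟩ := exists_extend (𝒟₁.union 𝒟₂)
      (Finset.univ.image fun ℓ : Fin k → Fin n => (DiPatternExpr.add e₁ e₂).value n ℓ) (by
      intro q hq
      obtain ⟨ℓ, -, rfl⟩ := Finset.mem_image.1 hq
      refine ⟨StepData.sum ((Finset.univ : Finset Bool).val.map fun i =>
        ((1 : ℂ), if i then e₁.value n ℓ else e₂.value n ℓ)), ?_, fun u hu => ?_⟩
      · rw [value_sum_one]
        simp
      · obtain ⟨i, -, rfl⟩ := mem_args_sum_one _ _ hu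
        cases i
        · exact ValueDerivation.mem_union_S_right (hv₂ ℓ)
        · exact ValueDerivation.mem_union_S_left (hv₁ ℓ))
    refine ⟨𝒟, fun ℓ => (h𝒟 _).2 (Or.inr (Finset.mem_image.2 ⟨ℓ, Finset.mem_univ _, rfl⟩)),
      fun q hq => ?_⟩
    rcases (h𝒟 q).1 hq with hq | hq
    · rcases ValueDerivation.mem_union_S.1 hq with hq | hq
      · exact hs₁ q hq
      · exact hs₂ q hq
    · obtain ⟨ℓ, -, rfl⟩ := Finset.mem_image.1 hq
      exact ⟨_, card_diLabels_le n ℓ, fun σ hσ => ren_diValue_of_fix n σ _ ℓ hσ⟩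
  | mul e₁ e₂ ih₁ ih₂ =>
    obtain ⟨𝒟₁, hv₁, hs₁⟩ := ih₁
    obtain ⟨𝒟₂, hv₂, hs₂⟩ := ih₂
    obtain ⟨𝒟, h𝒟⟩ := exists_extend (𝒟₁.union 𝒟₂)
      (Finset.univ.image fun ℓ : Fin k → Fin n => (DiPatternExpr.mul e₁ e₂).value n ℓ) (by
      intro q hq
      obtain ⟨ℓ, -, rfl⟩ := Finset.mem_image.1 hq
      refine ⟨StepData.prod (e₁.value n ℓ) (e₂.value n ℓ), rfl, fun u hu => ?_⟩
      simp only [StepData.args, Multiset.insert_eq_cons, Multiset.mem_cons, Multiset.mem_singleton] at hu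
      rcases hu with rfl | rfl
      · exact ValueDerivation.mem_union_S_left (hv₁ ℓ)
      · exact ValueDerivation.mem_union_S_right (hv₂ ℓ))
    refine ⟨𝒟, fun ℓ => (h𝒟 _).2 (Or.inr (Finset.mem_image.2 ⟨ℓ, Finset.mem_univ _, rfl⟩)),
      fun q hq => ?_⟩
    rcases (h𝒟 q).1 hq with hq | hq
    · rcases ValueDerivation.mem_union_S.1 hq with hq | hq
      · exact hs₁ q hq
      · exact hs₂ q hq
    · obtain ⟨ℓ, -, rfl⟩ := Finset.mem_image.1 hq
      exact ⟨_, card_diLabels_le n ℓ, fun σ hσ => ren_diValue_of_fix n σ _ ℓ hσ⟩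
  | sumLabel a e ih =>
    obtain ⟨𝒟₁, hv₁, hs₁⟩ := ih
    obtain ⟨𝒟, h𝒟⟩ := exists_extend 𝒟₁
      (Finset.univ.image fun ℓ : Fin k → Fin n => (DiPatternExpr.sumLabel a e).value n ℓ) (by
      intro q hq
      obtain ⟨ℓ, -, rfl⟩ := Finset.mem_image.1 hq
      refine ⟨StepData.sum ((Finset.univ : Finset (Fin n)).val.map fun v =>
        ((1 : ℂ), e.value n (Function.update ℓ a v))), ?_, fun u hu => ?_⟩
      · rw [value_sum_one]
        rfl
      · obtain ⟨v, -, rfl⟩ := mem_args_sum_one _ _ hu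
        exact hv₁ _)
    refine ⟨𝒟, fun ℓ => (h𝒟 _).2 (Or.inr (Finset.mem_image.2 ⟨ℓ, Finset.mem_univ _, rfl⟩)),
      fun q hq => ?_⟩
    rcases (h𝒟 q).1 hq with hq | hq
    · exact hs₁ q hq
    · obtain ⟨ℓ, -, rfl⟩ := Finset.mem_image.1 hq
      exact ⟨_, card_diLabels_le n ℓ, fun σ hσ => ren_diValue_of_fix n σ _ ℓ hσ⟩

/-- **The closed polynomial of a one-sorted expression has a supported value derivation** (one more
weighted sum over all assignments; the closed polynomial is diagonally invariant). [cite: DawarPagoSeppelt2025, §5] -/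
theorem exists_valueDerivation_diClose (e : DiPatternExpr ℂ k) :
    ∃ 𝒟 : ValueDerivation ℂ (Fin n × Fin n), e.close n ∈ 𝒟.S ∧
      ∀ q ∈ 𝒟.S, ∃ T : Finset (Fin n), T.card ≤ k ∧
        ∀ σ : Equiv.Perm (Fin n), (∀ i ∈ T, σ i = i) → ren σ q = q := by
  obtain ⟨𝒟₁, hv, hs⟩ := exists_valueDerivation_diValue n e
  obtain ⟨𝒟, h𝒟⟩ := exists_extend 𝒟₁ {e.close n} (by
    intro q hq
    rw [Finset.mem_singleton] at hq
    subst hq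
    refine ⟨StepData.sum ((Finset.univ : Finset (Fin k → Fin n)).val.map
      fun ℓ => ((1 : ℂ), e.value n ℓ)), ?_, fun u hu => ?_⟩
    · rw [value_sum_one]; rfl
    · obtain ⟨ℓ, -, rfl⟩ := mem_args_sum_one _ _ hu
      exact hv _)
  refine ⟨𝒟, (h𝒟 _).2 (Or.inr (Finset.mem_singleton.2 rfl)), fun q hq => ?_⟩
  rcases (h𝒟 q).1 hq with hq | hq
  · exact hs q hq
  · rw [Finset.mem_singleton] at hq
    subst hq
    exact ⟨∅, by simp, fun σ _ => DiPatternExpr.rename_perm_close n σ e⟩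

/-- **A closed one-sorted expression with `k` labels — of ANY length — has a square-symmetric circuit of
orbit size `≤ (n+1)^{2k+4}`.** [cite: DawarPagoSeppelt2025, §5] -/
theorem exists_symmetric_orbit_le_of_diClose (e : DiPatternExpr ℂ k) :
    ∃ (G : Type) (_ : Fintype G) (C : LabelledArithCircuit ℂ (Fin n × Fin n) Unit G),
      C.IsSymmetric (Equiv.Perm (Fin n)) ∧ C.eval (C.output ()) = e.close n ∧
        C.orbitSize (Equiv.Perm (Fin n)) ≤ (n + 1) ^ (2 * k + 4) := by
  obtain ⟨𝒟, hf, hs⟩ := exists_valueDerivation_diClose n e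
  exact ValueOrbit.qpOrbit_of_supportedDerivation 𝒟 hf (fun σ => DiPatternExpr.rename_perm_close n σ e) hs

/-- At `n = 1` the orbit size is `≤ 16`. [folklore] -/
theorem exists_symmetric_orbit_le_of_diClose_one (e : DiPatternExpr ℂ k) :
    ∃ (G : Type) (_ : Fintype G) (C : LabelledArithCircuit ℂ (Fin 1 × Fin 1) Unit G),
      C.IsSymmetric (Equiv.Perm (Fin 1)) ∧ C.eval (C.output ()) = e.close 1 ∧
        C.orbitSize (Equiv.Perm (Fin 1)) ≤ 16 := by
  obtain ⟨𝒟, hf, -⟩ := exists_valueDerivation_diClose 1 e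
  obtain ⟨G, inst, C, hC, hev, horb⟩ := ValueOrbit.qpOrbit_of_supportedDerivation (k := 0) 𝒟 hf
    (fun σ => DiPatternExpr.rename_perm_close 1 σ e)
    (fun q _ => ⟨∅, le_rfl, fun σ _ => by rw [Subsingleton.elim σ 1, ren_one]⟩)
  exact ⟨G, inst, C, hC, hev, horb.trans (by norm_num)⟩

/-- **ONE-SORTED NARROW EXPRESSIONS HAVE QUASI-POLYNOMIAL ORBITS.**  If `f n` is, for every `n ≥ 1`, the
closed polynomial of a one-sorted expression with `k_n` labels, `n^{k_n} ≤ 2^{(log₂ n + c)^c}`, of ANY length,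
then `f` has square-symmetric circuits of orbit size `≤ 2^{(log₂ n + c + 4)^{c+4}}` (the easy direction of
the conjectured one-sorted characterisation; no symmetry hypothesis on `f`). [cite: DawarPagoSeppelt2025, §7 (p. 45)] -/
theorem qpOrbit_of_diNarrowExpression (f : (n : ℕ) → MvPolynomial (Fin n × Fin n) ℂ)
    (h : ∃ c : ℕ, ∀ n : ℕ, 1 ≤ n → ∃ (k : ℕ) (e : DiPatternExpr ℂ k),
      n ^ k ≤ 2 ^ ((Nat.log 2 n + c) ^ c) ∧ e.close n = f n) :
    ∃ c : ℕ, ∀ n : ℕ, ∃ (G : Type) (_ : Fintype G)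
      (C : LabelledArithCircuit ℂ (Fin n × Fin n) Unit G),
      C.IsSymmetric (Equiv.Perm (Fin n)) ∧ C.eval (C.output ()) = f n ∧
      C.orbitSize (Equiv.Perm (Fin n)) ≤ 2 ^ ((Nat.log 2 n + c) ^ c) := by
  obtain ⟨c, hc⟩ := h
  refine ⟨c + 4, fun n => ?_⟩
  rcases Nat.lt_or_ge n 2 with hn | hn
  · interval_cases n
    · obtain ⟨G, inst, C, hC, hev, hcard⟩ := zeta_symmetric_constant (X := Fin 0 × Fin 0)
        (Γ := Equiv.Perm (Fin 0)) (MvPolynomial.coeff 0 (f 0))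
      refine ⟨G, inst, C, hC, ?_, ((C.orbitSize_le_size _).trans hcard).trans Nat.one_le_two_pow⟩
      rw [hev]
      exact (MvPolynomial.eq_C_of_isEmpty (f 0)).symm
    · obtain ⟨k, e, -, he⟩ := hc 1 le_rfl
      obtain ⟨G, inst, C, hC, hev, horb⟩ := exists_symmetric_orbit_le_of_diClose_one e
      refine ⟨G, inst, C, hC, hev.trans he, horb.trans ?_⟩
      have h4 : 4 ≤ (Nat.log 2 1 + (c + 4)) ^ (c + 4) :=
        le_trans (by simp) (Nat.le_self_pow (by omega) (Nat.log 2 1 + (c + 4)))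
      exact le_trans (by norm_num) (Nat.pow_le_pow_right (by norm_num) h4)
  · obtain ⟨k, e, hk, he⟩ := hc n (by omega)
    obtain ⟨G, inst, C, hC, hev, horb⟩ := exists_symmetric_orbit_le_of_diClose n e
    exact ⟨G, inst, C, hC, hev.trans he, horb.trans (orbit_arith hn hk)⟩

end NarrowToOrbit

end Summit.ValiantsHypothesis.ValiantsHypothesis.Theorems

end
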